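import Summits.Ventures.PercRepro.S1CoreCapSevenZero

/-!
# PercRepro — TOWARDS `Q*(8)`: NO BIG LINE (p1, gen 27)

The case of 3-point lines only at nullity `8`, with fat points — the `ν = 8` reading of
`S1CoreCapSevenZero` (the devices are budget-parametric; only the constants move by one). If no two lines
meet, every line is free in every order and every fat point lies on one line: cap `= #lines + #fat ≤ 8`
(`sum_cap_le_eight_of_pairwise_disjoint`). Otherwise take a PLANE `l` on two meeting lines
(`S1CoreCapSevenPlane`): `c = |unionL l| ∈ {5, …, 9}`, `f₀` fat points in it, `costSum l ≥ c + f₀ − 3`. Inside the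
plane `3 · #l ≤ C(c, 2)` and a fat point of the plane lies on at most `(c − 1) / 2` of its lines
(`Seven.sum_fat_plane_le`); outside, the lines form a thin family over the plane with budget `b = 11 − c − f₀`
on free lines and new fat points (`budget_over_plane₈`), of cap `≤ b (b + 1) / 2 + f₀ b`
(`Seven.two_mul_sum_cap_thin_le`). The table over `(c, f₀)` with `c + f₀ ≤ 11` reads at most `25` (the crude
count at `(5, 1)` and `(5, 2)`): `sum_cap_le_twenty_five_of_no_big`. `proofs/P1-S4-CAPBRIDGE.md` §19.
Axioms: standard.
-/

namespace PercRepro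

namespace S1

namespace FourCap

namespace Eight

open Seven

variable {β : Type} [DecidableEq β]

section NoBig

variable {w : β → ℕ} {ls : Finset (Finset β)}
  (h1 : ∀ L ∈ ls, ∀ v ∈ L, w v = 1 ∨ w v = 2)
  (h2 : ∀ L ∈ ls, 3 ≤ L.card ∧ wsum w L ≤ 5)
  (h3 : ∀ L ∈ ls, ∀ L' ∈ ls, L ≠ L' → (L ∩ L').card ≤ 1)
  (h4 : ∀ l : List (Finset β), l.Nodup → (∀ L ∈ l, L ∈ ls) → wsum w (unionL l) ≤ 8 + lineRank l)
  (h5 : ∀ l : List (Finset β), l.Nodup → (∀ L ∈ l, L ∈ ls) → lineRank l ≤ 3 → (unionL l).card ≤ 9)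

include h1 h2 h4 in
/-- **Pairwise disjoint lines at nullity `8`: cap `≤ 8`** — every line is free in any order and every fat point
is new once. -/
theorem sum_cap_le_eight_of_pairwise_disjoint (hall : ∀ L ∈ ls, L.card = 3)
    (hdisj : ∀ L ∈ ls, ∀ L' ∈ ls, L ≠ L' → (L ∩ L').card = 0) :
    ∑ L ∈ ls, capPaper L.card (fat w L) ≤ 8 := by
  -- the full list is a free sequence
  have hfree : ∀ t : List (Finset β), t.Nodup → (∀ L ∈ t, L ∈ ls) → freeCountR ∅ t = t.length := by
    intro t
    induction t with
    | nil => intros; rfl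
    | cons L t ih =>
      intro hnd hls
      have hL := hls L List.mem_cons_self
      have hsd : 0 < L.card := by rw [hall L hL]; omega
      obtain ⟨v, hv⟩ := Finset.card_pos.1 hsd
      rw [freeCountR_cons_of_new hv (Finset.notMem_empty v) (fun L' hL' hvL' => by
        have hne : L ≠ L' := fun h => (List.nodup_cons.1 hnd).1 (h ▸ hL')
        have := hdisj L hL L' (hls L' (List.mem_cons_of_mem _ hL')) hne
        rw [Finset.card_eq_zero] at this
        exact Finset.notMem_empty v (this ▸ Finset.mem_inter.2 ⟨hv, hvL'⟩)),
        ih (List.nodup_cons.1 hnd).2 (fun L' hL' => hls L' (List.mem_cons_of_mem _ hL'))]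
      rfl
  have hb := budget_of_prefix h1 (two_le_card_of_spec₇ h2) h4 [] ls.toList (by simpa using Finset.nodup_toList ls)
    (fun L hL => by simpa using hL) (fun L hL => hall L (Finset.mem_toList.1 hL))
  simp only [unionL, costSum, Nat.zero_add] at hb
  rw [hfree ls.toList (Finset.nodup_toList ls) (fun L hL => Finset.mem_toList.1 hL), Finset.length_toList] at hb
  have hf0 : fat w (∅ : Finset β) = 0 := by simp [fat]
  -- the fat points of the union are the fat points of the lines, each on one line
  have hU : unionLR ∅ ls.toList = ls.biUnion id := by
    ext v
    simp only [mem_unionLR_iff, Finset.notMem_empty, false_or, Finset.mem_biUnion, Finset.mem_toList, id_eq]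
  have hdisjf : ∀ L ∈ ls, ∀ L' ∈ ls, L ≠ L' →
      Disjoint (L.filter (fun u => w u = 2)) (L'.filter (fun u => w u = 2)) := by
    intro L hL L' hL' hne
    rw [Finset.disjoint_left]
    intro u hu hu'
    have := hdisj L hL L' hL' hne
    rw [Finset.card_eq_zero] at this
    exact Finset.notMem_empty u (this ▸ Finset.mem_inter.2 ⟨(Finset.mem_filter.1 hu).1, (Finset.mem_filter.1 hu').1⟩)
  have hsumfat : ∑ L ∈ ls, fat w L = fat w (ls.biUnion id) := by
    unfold fat
    rw [← Finset.card_biUnion hdisjf]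
    congr 1
    ext u
    simp only [Finset.mem_biUnion, Finset.mem_filter, id_eq]
    constructor
    · rintro ⟨L, hL, hu, h2⟩; exact ⟨⟨L, hL, hu⟩, h2⟩
    · rintro ⟨⟨L, hL, hu⟩, h2⟩; exact ⟨L, hL, hu, h2⟩
  have hcap : ∀ L ∈ ls, capPaper L.card (fat w L) = 1 + fat w L := by
    intro L hL
    have := wsum_eq_card_add_fat w L (h1 L hL)
    have := (h2 L hL).2
    have := hall L hL
    rw [hall L hL, capPaper_three_eq' (by omega)]
  rw [Finset.sum_congr rfl hcap, Finset.sum_add_distrib, Finset.sum_const_nat (m := 1) (fun _ _ => rfl), hsumfat]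
  rw [hU] at hb
  omega

include h1 h2 h4 in
/-- **The budget over a plane at nullity `8`, with fat points**: a list `t` of 3-point lines of the configuration
outside a list `l` with `lineRank l ≤ 3` has `freeCountR (unionL l) t + fat (unionLR (unionL l) t ∖ unionL l) +
|unionL l| + fat (unionL l) ≤ 11`. -/
theorem budget_over_plane₈ {l : List (Finset β)} (hr : lineRank l ≤ 3) (t : List (Finset β))
    (hnd : (t ++ l).Nodup) (hls : ∀ L ∈ t ++ l, L ∈ ls) (h3t : ∀ L ∈ t, L.card = 3) :
    freeCountR (unionL l) t + fat w (unionLR (unionL l) t \ unionL l) + (unionL l).card + fat w (unionL l) ≤ 11 := by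
  have hb := budget_of_prefix h1 (two_le_card_of_spec₇ h2) h4 l t hnd hls h3t
  have hl : ∀ L ∈ l, L ∈ ls := fun L hL => hls L (List.mem_append_right _ hL)
  have hc := wsum_unionL_eq w l (fun L hL => h1 L (hl L hL)) (fun L hL => two_le_card_of_spec₇ h2 L (hl L hL))
  rw [wsum_eq_card_add_fat w (unionL l) (fun v hv => by
    obtain ⟨L, hL, hvL⟩ := mem_unionL_iff.1 hv
    exact h1 L (hl L hL) v hvL)] at hc
  have hsplit := fat_sdiff_add_fat_of_subset w (subset_unionLR (unionL l) t)
  omega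

include h1 h2 h3 h4 h5 in
/-- **No big line at nullity `8`: cap sum `≤ 25`** — pairwise disjoint lines give `≤ 8`; otherwise the plane on
two meeting lines has `c ∈ {5, …, 9}` points and `f₀` fat points, cap `≤ C(c, 2)/3 + f₀ (c − 1)/2` inside and
`≤ b (b + 1)/2 + f₀ b` outside at budget `b = 11 − c − f₀`. -/
theorem sum_cap_le_twenty_five_of_no_big (hall : ∀ L ∈ ls, L.card = 3) :
    ∑ L ∈ ls, capPaper L.card (fat w L) ≤ 25 := by
  by_cases hmeet : ∃ L₁ ∈ ls, ∃ L₂ ∈ ls, L₂ ≠ L₁ ∧ (L₂ ∩ L₁).card = 1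
  · obtain ⟨L₁, hL₁, L₂, hL₂, hne, hint⟩ := hmeet
    have h2' := two_le_card_of_spec₇ h2
    obtain ⟨l, hnd, hls, hr, hsub, hmax⟩ := exists_plane ls _ [L₂, L₁] le_rfl (by simp [hne])
      (by simp [hL₁, hL₂]) (by rw [lineRank_pair_eq_three (h2' L₁ hL₁) (h2' L₂ hL₂) hint])
    have hc9 : (unionL l).card ≤ 9 := card_plane_le_nine h5 hnd hls hr
    have hc5 : 5 ≤ (unionL l).card := five_le_card_plane (h2 L₁ hL₁).1 (h2 L₂ hL₂).1 hint.le (hsub L₁ (by simp))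
      (hsub L₂ (by simp))
    -- inside the plane
    have hin : 3 * l.length ≤ (unionL l).card.choose 2 := three_mul_length_le_choose_two l hnd
      (fun L hL => hall L (hls L hL)) (fun L hL L' hL' hne => h3 L (hls L hL) L' (hls L' hL') hne)
    have hfatin := sum_fat_plane_le w l (fun L hL => hall L (hls L hL))
      (fun L hL L' hL' hne => h3 L (hls L hL) L' (hls L' hL') hne)
    -- outside the plane: a thin family
    set T := ls.filter (fun L => L ∉ l) with hT
    have hTmem : ∀ L ∈ T, L ∈ ls ∧ L ∉ l := fun L hL => Finset.mem_filter.1 hL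
    have hk : ∀ t : List (Finset β), t.Nodup → (∀ L ∈ t, L ∈ T) →
        freeCountR (unionL l) t + fat w (unionLR (unionL l) t \ unionL l) ≤
          11 - (unionL l).card - fat w (unionL l) := by
      intro t hndt hlt
      have hb := budget_over_plane₈ h1 h2 h4 hr t (by
        rw [List.nodup_append']
        exact ⟨hndt, hnd, fun L hLt hLl => (hTmem L (hlt L hLt)).2 hLl⟩)
        (fun L hL => by
          rcases List.mem_append.1 hL with hL | hL
          · exact (hTmem L (hlt L hL)).1
          · exact hls L hL)
        (fun L hL => hall L (hTmem L (hlt L hL)).1)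
      omega
    have hthin := two_mul_sum_cap_thin_le w (unionL l) T
      (fun L hL => ⟨hall L (hTmem L hL).1, hmax L (hTmem L hL).1 (hTmem L hL).2⟩)
      (fun L hL L' hL' hne => h3 L (hTmem L hL).1 L' (hTmem L' hL').1 hne)
      (fun L hL => h1 L (hTmem L hL).1) (fun L hL => (h2 L (hTmem L hL).1).2) hk
    -- `c + f₀ ≤ 11`
    have hcost : (unionL l).card + fat w (unionL l) ≤ 11 := by
      have := budget_over_plane₈ h1 h2 h4 hr [] (by simpa using hnd) (by simpa using hls) (by simp)
      omega
    -- the split of the sum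
    have hsplit := Finset.sum_filter_add_sum_filter_not ls (fun L => L ∈ l) (fun L => capPaper L.card (fat w L))
    have hfil : ls.filter (fun L => L ∈ l) = l.toFinset := by
      ext L
      simp only [Finset.mem_filter, List.mem_toFinset]
      exact ⟨fun h => h.2, fun h => ⟨hls L h, h⟩⟩
    rw [hfil, ← hT] at hsplit
    rw [← hsplit]
    have hcapl : ∀ L ∈ l.toFinset, capPaper L.card (fat w L) = 1 + fat w L := by
      intro L hL
      have hL' := hls L (List.mem_toFinset.1 hL)
      have := wsum_eq_card_add_fat w L (h1 L hL')
      have := (h2 L hL').2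
      have := hall L hL'
      rw [hall L hL', capPaper_three_eq' (by omega)]
    rw [Finset.sum_congr rfl hcapl, Finset.sum_add_distrib, Finset.sum_const_nat (m := 1) (fun _ _ => rfl),
      List.toFinset_card_of_nodup hnd, Nat.mul_one]
    rw [Nat.choose_two_right] at hin
    -- the table
    generalize hc : (unionL l).card = c at hin hfatin hthin hcost hc5 hc9
    generalize hf : fat w (unionL l) = f₀ at hfatin hthin hcost
    generalize l.length = a at hin ⊢
    generalize ∑ L ∈ l.toFinset, fat w L = b at hfatin ⊢
    generalize ∑ L ∈ T, capPaper L.card (fat w L) = d at hthin ⊢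
    have hf6 : f₀ ≤ 6 := by omega
    interval_cases c <;> interval_cases f₀ <;> omega
  · push Not at hmeet
    refine (sum_cap_le_eight_of_pairwise_disjoint h1 h2 h4 hall (fun L hL L' hL' hne => ?_)).trans (by omega)
    rw [Finset.inter_comm]
    have := h3 L' hL' L hL hne.symm
    have := hmeet L hL L' hL' hne.symm
    omega

end NoBig

end Eight

end FourCap

end S1

end PercRepro
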